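import Literature.Computability.Complexity.Williams2014GateFormulas
import Literature.Computability.Complexity.Williams2014Seeds
import HarnessLib

/-!
# The explicit Beigel–Tarui collapse and the explicit `SYM⁺` circuit of an `ACC` circuit

R. Beigel, J. Tarui, *On ACC*, Comput. Complexity 4 (1994), §2.3–2.4 (Lemma 2.8, Thm. 1.1);
R. Williams, *Nonuniform ACC circuit lower bounds*, J. ACM 61 (2014), Lemma 4.1 and Appendix A
(Transformations 3–4). The tree's `SymPlusProofs.lean` proves the EXISTENCE of the `SYM⁺` circuit
through the invariant `BT.Setup.Inv` (`∃ R h, …`), choosing at every stage the amplification depth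
from the actual weight of the current formula. For Williams' ALGORITHM (Lemma 4.1) the same collapse
is carried out here as explicit data, all parameters being closed arithmetic expressions in
`λ = log₂ s + 2`:

* stage data (`k` stages done, levels `Lmax, Lmax-1, …` eliminated from the top, `Lmax = (m+1)·d`):
  exponents `Eexp a e₀ k` (`e₀`, then `E ↦ 3E + a + 5`), weight bounds `Wb = 2^{λ^E}`, amplification
  depths `kap = log₂ (λ^E + 2) + 1`, stage primes `pSt = max 2 (stagePrime (Lmax - k))`, batches
  `Batch ℓ = {v | Adm v ∧ level v = ℓ}` (decidable, `decAdm`), substitutions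
  `tau k = collapseSubst (Batch (Lmax-k)) FF' (pSt k) (kap k)`, formulas `Rk 0 = Σ_{c<T} ℓ_c(output)`,
  `Rk (k+1) = (Rk k).subst (tau k)`, decoders `Dk k z = ((z + Wb k) mod pSt k ^ 2^{kap k}) - Wb k` and
  their composite `chain k = Dk 0 ∘ ⋯ ∘ Dk (k-1)`;
* **`inv_explicit`** — after `k ≤ Lmax` stages: `C x = [T < 2 · chain k ((Rk k)(val x))]` for every
  input `x` (given the majority hypothesis for the `T` copies), `Rk k` mentions only admissible
  variables of level `≤ Lmax - k`, `deg ≤ λ^{E_k}`, `wt ≤ 2^{λ^{E_k}}` (the tree's `inv_init` /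
  `inv_step` made explicit and uniform: a stage with an empty batch is the identity and its decoder
  is the identity on the relevant range, `subst_collapse_of_empty`, `AForm.decode_eq`);
* **`explicitSymPlus`** — the `SYM⁺` circuit read off `Rk Lmax`: a monomial with coefficient `a`
  becomes `a mod K_f` copies of its AND-term (`K_f = 2·Wb Lmax + 1`), the symmetric gate decodes the
  count (`symOf`); `size_explicitSymPlus_le`, `maxFanIn_explicitSymPlus_le`, `eval_explicitSymPlus`
  (the tree's `symPlus_of_inv` for this explicit circuit);
* `numeric_bounds_vv` — the side conditions of the stages for the Valiant–Vazirani seeds of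
  `Williams2014Seeds.lean` (`T₀ = vvT₀ s ≤ 12 λ²`, exponent `a = 4m + 10`).

No new named fact; everything is proved. The polynomial-time implementation mirrors `Rk`, `tau`,
`symOf` token by token (`Williams2014Expand.lean` and the `CodeFP` files).

## References

* R. Beigel, J. Tarui, *On ACC*, Comput. Complexity 4 (1994), Lemma 2.8, §2.3–2.4, Thm. 1.1
  [BeigelTarui1994].
* R. Williams, *Nonuniform ACC circuit lower bounds*, J. ACM 61 (2014), Lemma 4.1, Appendix A
  [Williams2014].
-/

namespace Literature.Computability.Complexity

open Finset

namespace AForm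

variable {σ : Type*}

/-- Substituting every variable by itself is the identity. [folklore] -/
theorem subst_var_self : ∀ F : AForm σ, F.subst AForm.var = F
  | var _ => rfl
  | cst _ => rfl
  | add F G => by rw [subst, subst_var_self F, subst_var_self G]
  | mul F G => by rw [subst, subst_var_self F, subst_var_self G]

/-- A collapse step with an empty batch is the identity. [folklore] -/
theorem subst_collapse_of_empty {B : σ → Prop} [DecidablePred B] (hB : ∀ v, ¬ B v) (F : σ → AForm σ)
    (p κ : ℕ) (R : AForm σ) : R.subst (collapseSubst B F p κ) = R := by
  have : collapseSubst B F p κ = AForm.var := by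
    funext v; unfold collapseSubst; rw [if_neg (hB v)]
  rw [this, subst_var_self]

end AForm

namespace BT

/-! ### Numeric side conditions for the Valiant–Vazirani parameters -/

/-- `vvT₀ s ≤ 12 λ²` with `λ = log₂ s + 2`. [folklore] -/
theorem vvT₀_le (s : ℕ) : vvT₀ s ≤ 12 * (Nat.log 2 s + 2) ^ 2 := by
  unfold vvT₀ vvR vvK vvMu
  nlinarith [Nat.zero_le (Nat.log 2 s)]

/-- `1 ≤ vvT₀ s`. [folklore] -/
theorem one_le_vvT₀ (s : ℕ) : 1 ≤ vvT₀ s := by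
  unfold vvT₀ vvR vvK vvMu; nlinarith [Nat.zero_le (Nat.log 2 s)]

/-- `vvBits s ≤ 12 λ³` with `λ = log₂ s + 2`. [folklore] -/
theorem vvBits_le (s : ℕ) : vvBits s ≤ 12 * (Nat.log 2 s + 2) ^ 3 := by
  unfold vvBits vvR vvK vvMu
  set L := Nat.log 2 s
  have h : (L + 1 + 2) * (L + 1 + 1) ≤ 2 * (L + 2) * (L + 2) := by nlinarith
  calc 6 * (L + 2) * ((L + 1 + 2) * (L + 1 + 1)) ≤ 6 * (L + 2) * (2 * (L + 2) * (L + 2)) :=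
        Nat.mul_le_mul_left _ h
    _ = 12 * (L + 2) ^ 3 := by ring

/-- `2 · vvT s + 1 ≤ 2^{λ^7}` with `λ = log₂ s + 2`: the weight of the top formula (one literal per
copy) is within the initial bound. [folklore] -/
theorem two_mul_vvT_succ_le (s : ℕ) : 2 * vvT s + 1 ≤ 2 ^ (Nat.log 2 s + 2) ^ 7 := by
  set lam := Nat.log 2 s + 2 with hlam
  have h2 : 2 ≤ lam := by omega
  have hbits : vvBits s + 2 ≤ lam ^ 7 := by
    have hb : vvBits s ≤ 12 * lam ^ 3 := vvBits_le s
    have h16 : 16 ≤ lam ^ 4 := by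
      calc 16 = 2 ^ 4 := rfl
        _ ≤ lam ^ 4 := Nat.pow_le_pow_left h2 4
    have h1 : 1 ≤ lam ^ 3 := Nat.one_le_pow _ _ (by omega)
    calc vvBits s + 2 ≤ 12 * lam ^ 3 + 4 * lam ^ 3 := by omega
      _ = 16 * lam ^ 3 := by ring
      _ ≤ lam ^ 4 * lam ^ 3 := Nat.mul_le_mul_right _ h16
      _ = lam ^ 7 := by rw [← pow_add]
  unfold vvT
  calc 2 * 2 ^ vvBits s + 1 ≤ 2 * 2 ^ vvBits s + 2 * 2 ^ vvBits s := by
        have := Nat.one_le_two_pow (n := vvBits s); omega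
    _ = 2 ^ (vvBits s + 2) := by rw [pow_add]; ring
    _ ≤ 2 ^ lam ^ 7 := Nat.pow_le_pow_right two_pos hbits

/-- **The numeric side conditions of the stages** for `T₀ = vvT₀ s`, `λ = log₂ s + 2` and the weight
bound `(3s+3)^{T₀+m³}` of the gate polynomials, with the exponent `a = 4m + 10`:
`m (T₀ + m³) ≤ λ^a` and `5 ((3s+3)^{T₀+m³})^m ≤ 2^{λ^a}`. [folklore] -/
theorem numeric_bounds_vv (s : ℕ) {m : ℕ} (hm : 2 ≤ m) :
    m * (vvT₀ s + m ^ 3) ≤ (Nat.log 2 s + 2) ^ (4 * m + 10) ∧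
    5 * ((3 * s + 3) ^ (vvT₀ s + m ^ 3)) ^ m ≤ 2 ^ (Nat.log 2 s + 2) ^ (4 * m + 10) := by
  set L := Nat.log 2 s with hL
  have hs : s < 2 ^ (L + 1) := Nat.lt_pow_succ_log_self one_lt_two s
  set lam := L + 2 with hlam
  have h2 : 2 ≤ lam := by omega
  have h1 : 1 ≤ lam := by omega
  have hm' : m ≤ lam ^ m := (Nat.lt_two_pow_self).le.trans (Nat.pow_le_pow_left h2 m)
  -- `T₀ + m³ ≤ λ^{3m+7}`
  have hDF : vvT₀ s + m ^ 3 ≤ lam ^ (3 * m + 7) := by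
    have hT : vvT₀ s ≤ lam ^ 6 := by
      refine (vvT₀_le s).trans ?_
      rw [← hL, ← hlam]
      have h16 : 12 ≤ lam ^ 4 := le_trans (by norm_num) (Nat.pow_le_pow_left h2 4)
      calc 12 * lam ^ 2 ≤ lam ^ 4 * lam ^ 2 := Nat.mul_le_mul_right _ h16
        _ = lam ^ 6 := by rw [← pow_add]
    have hm3 : m ^ 3 ≤ lam ^ (3 * m) := by
      rw [pow_mul']; exact Nat.pow_le_pow_left hm' 3
    have hA : lam ^ 6 ≤ lam ^ (3 * m + 6) := Nat.pow_le_pow_right h1 (by omega)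
    have hB : lam ^ (3 * m) ≤ lam ^ (3 * m + 6) := Nat.pow_le_pow_right h1 (by omega)
    calc vvT₀ s + m ^ 3 ≤ lam ^ (3 * m + 6) + lam ^ (3 * m + 6) := add_le_add (hT.trans hA) (hm3.trans hB)
      _ = 2 * lam ^ (3 * m + 6) := by ring
      _ ≤ lam * lam ^ (3 * m + 6) := Nat.mul_le_mul_right _ h2
      _ = lam ^ (3 * m + 7) := by rw [← pow_succ']
  constructor
  · calc m * (vvT₀ s + m ^ 3) ≤ lam ^ m * lam ^ (3 * m + 7) := Nat.mul_le_mul hm' hDF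
      _ = lam ^ (4 * m + 7) := by rw [← pow_add]; congr 1; ring
      _ ≤ lam ^ (4 * m + 10) := Nat.pow_le_pow_right h1 (by omega)
  · have h3s : 3 * s + 3 ≤ 2 ^ (lam + 1) := by
      have : 2 ^ (lam + 1) = 2 ^ (L + 1) * 4 := by rw [hlam]; ring
      omega
    have hl1 : lam + 1 ≤ lam ^ 2 := by nlinarith
    have hexp : (lam + 1) * ((vvT₀ s + m ^ 3) * m) + 3 ≤ lam ^ (4 * m + 10) := by
      have hprod : (lam + 1) * ((vvT₀ s + m ^ 3) * m) ≤ lam ^ (4 * m + 9) :=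
        calc _ ≤ lam ^ 2 * (lam ^ (3 * m + 7) * lam ^ m) := Nat.mul_le_mul hl1 (Nat.mul_le_mul hDF hm')
          _ = lam ^ (4 * m + 9) := by rw [← pow_add, ← pow_add]; congr 1; ring
      have h3 : 3 ≤ lam ^ (4 * m + 9) :=
        calc 3 ≤ lam ^ 2 := by nlinarith
          _ ≤ _ := Nat.pow_le_pow_right h1 (by omega)
      calc _ ≤ lam ^ (4 * m + 9) + lam ^ (4 * m + 9) := add_le_add hprod h3
        _ = 2 * lam ^ (4 * m + 9) := by ring
        _ ≤ lam * lam ^ (4 * m + 9) := Nat.mul_le_mul_right _ h2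
        _ = lam ^ (4 * m + 10) := by rw [← pow_succ']
    calc 5 * ((3 * s + 3) ^ (vvT₀ s + m ^ 3)) ^ m ≤ 2 ^ 3 * ((2 ^ (lam + 1)) ^ (vvT₀ s + m ^ 3)) ^ m :=
          Nat.mul_le_mul (by norm_num) (Nat.pow_le_pow_left (Nat.pow_le_pow_left h3s _) _)
      _ = 2 ^ ((lam + 1) * ((vvT₀ s + m ^ 3) * m) + 3) := by
          rw [← pow_mul, ← pow_mul, ← pow_add]; congr 1; ring
      _ ≤ 2 ^ lam ^ (4 * m + 10) := Nat.pow_le_pow_right two_pos hexp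

namespace Setup

variable {n : ℕ} (K : Setup n)

/-! ### Decidable admissibility and the batches -/

/-- Admissibility is decidable. [folklore] -/
instance decAdm : DecidablePred K.Adm := fun v =>
  match v with
  | .inl _ => isTrue trivial
  | .inr (_, _, 0) => inferInstanceAs (Decidable (_ ∧ _))
  | .inr (_, _, _ + 1) => inferInstanceAs (Decidable (_ ∧ _ ∧ _))

/-- The batch of level `ℓ`: the admissible variables of that level. [cite: BeigelTarui1994, Lemma 2.8] -/
def Batch (ℓ : ℕ) (v : V n) : Prop := K.Adm v ∧ K.level v = ℓ

/-- The batches are decidable. [folklore] -/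
instance decBatch (ℓ : ℕ) : DecidablePred (K.Batch ℓ) := fun _ => inferInstanceAs (Decidable (_ ∧ _))

/-! ### Stage data -/

/-- Exponents: `E₀ = e₀`, `E_{k+1} = 3 E_k + a + 5`. [cite: BeigelTarui1994, Lemma 2.8] -/
def Eexp (a e₀ : ℕ) : ℕ → ℕ
  | 0 => e₀
  | k + 1 => 3 * Eexp a e₀ k + a + 5

/-- Weight bound after `k` stages: `2^{λ^{E_k}}`. [cite: BeigelTarui1994, Lemma 2.8] -/
def Wb (lam a e₀ k : ℕ) : ℕ := 2 ^ lam ^ Eexp a e₀ k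

/-- Amplification depth of stage `k`: `log₂ (λ^{E_k} + 2) + 1`. [cite: BeigelTarui1994, §2.3] -/
def kap (lam a e₀ k : ℕ) : ℕ := Nat.log 2 (lam ^ Eexp a e₀ k + 2) + 1

/-- The prime of stage `k` (level `Lmax - k`), at least `2`. [cite: BeigelTarui1994, Lemma 2.8] -/
def pSt (Lmax k : ℕ) : ℕ := max 2 (K.stagePrime (Lmax - k))

/-- The modulus of stage `k`: `pSt ^ 2^{kap}`. [cite: BeigelTarui1994, §2.3] -/
def Mk (lam a e₀ Lmax k : ℕ) : ℕ := K.pSt Lmax k ^ 2 ^ kap lam a e₀ k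

/-- The substitution of stage `k`. [cite: BeigelTarui1994, Lemma 2.8] -/
noncomputable def tau (lam a e₀ Lmax k : ℕ) : V n → AForm (V n) :=
  AForm.collapseSubst (K.Batch (Lmax - k)) K.FF' (K.pSt Lmax k) (kap lam a e₀ k)

/-- The formula after `k` stages: the sum of the output literals of the `T` copies, collapsed `k`
times. [cite: BeigelTarui1994, Lemma 2.5 and Lemma 2.8] -/
noncomputable def Rk (T lam a e₀ Lmax : ℕ) : ℕ → AForm (V n)
  | 0 => AForm.sumL ((List.range T).map fun c => K.litF c K.C.output)
  | k + 1 => (Rk T lam a e₀ Lmax k).subst (K.tau lam a e₀ Lmax k)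

/-- The decoder of stage `k`: recovers the value before the stage from the value after it.
[cite: BeigelTarui1994, §2.4] -/
def Dk (lam a e₀ Lmax k : ℕ) (z : ℤ) : ℤ :=
  (z + Wb lam a e₀ k) % (K.Mk lam a e₀ Lmax k : ℤ) - Wb lam a e₀ k

/-- The composite decoder of the first `k` stages: `Dk 0 ∘ ⋯ ∘ Dk (k-1)`. [cite: BeigelTarui1994, §2.4] -/
def chain (lam a e₀ Lmax : ℕ) : ℕ → ℤ → ℤ
  | 0 => id
  | k + 1 => chain lam a e₀ Lmax k ∘ K.Dk lam a e₀ Lmax k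

/-! ### Elementary facts on the stage data -/

/-- `pSt ≥ 2`. [folklore] -/
theorem two_le_pSt (Lmax k : ℕ) : 2 ≤ K.pSt Lmax k := le_max_left _ _

/-- `stagePrime ≤ m + 1`. [folklore] -/
theorem stagePrime_le (L : ℕ) : K.stagePrime L ≤ K.m + 1 := by
  unfold stagePrime
  split_ifs
  · have := K.two_le_m; omega
  · exact Nat.sub_le _ _

/-- `pSt - 1 ≤ m`. [folklore] -/
theorem pSt_sub_one_le (Lmax k : ℕ) : K.pSt Lmax k - 1 ≤ K.m := by
  have := K.stagePrime_le (Lmax - k); have := K.two_le_m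
  unfold pSt; omega

/-- On a nonempty batch the stage prime is the prime of its variables. [folklore] -/
theorem pSt_eq_primeOf {Lmax k : ℕ} {v : V n} (hv : K.Batch (Lmax - k) v) (hl : Lmax - k ≠ 0) :
    K.pSt Lmax k = primeOf v := by
  have h := K.stagePrime_level hv.1 (by rw [hv.2]; exact hl)
  rw [hv.2] at h
  unfold pSt
  rw [h]
  exact max_eq_right (K.prime_primeOf hv.1).two_le

/-- `2^{kap} > λ^E + 1`. [folklore] -/
theorem lt_two_pow_kap (lam a e₀ k : ℕ) : lam ^ Eexp a e₀ k + 2 < 2 ^ kap lam a e₀ k :=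
  Nat.lt_pow_succ_log_self one_lt_two _

/-- `2^{kap} ≤ 4 λ^E` once `λ^E ≥ 2`. [folklore] -/
theorem two_pow_kap_le {lam a e₀ k : ℕ} (h2E : 2 ≤ lam ^ Eexp a e₀ k) : 2 ^ kap lam a e₀ k ≤ 4 * lam ^ Eexp a e₀ k := by
  unfold kap
  calc 2 ^ (Nat.log 2 (lam ^ Eexp a e₀ k + 2) + 1) = 2 ^ Nat.log 2 (lam ^ Eexp a e₀ k + 2) * 2 := pow_succ _ _
    _ ≤ (lam ^ Eexp a e₀ k + 2) * 2 := Nat.mul_le_mul_right _ (Nat.pow_log_le_self 2 (by omega))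
    _ ≤ 4 * lam ^ Eexp a e₀ k := by omega

/-- The modulus of a stage exceeds twice the weight bound. [folklore] -/
theorem two_mul_Wb_lt_Mk (lam a e₀ Lmax k : ℕ) : 2 * (Wb lam a e₀ k : ℤ) < (K.Mk lam a e₀ Lmax k : ℤ) := by
  have hnat : 2 * Wb lam a e₀ k < K.Mk lam a e₀ Lmax k := by
    unfold Wb Mk
    calc 2 * 2 ^ lam ^ Eexp a e₀ k = 2 ^ (lam ^ Eexp a e₀ k + 1) := by rw [pow_succ]; ring
      _ < 2 ^ 2 ^ kap lam a e₀ k := Nat.pow_lt_pow_right one_lt_two (by have := lt_two_pow_kap lam a e₀ k; omega)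
      _ ≤ K.pSt Lmax k ^ 2 ^ kap lam a e₀ k := Nat.pow_le_pow_left (K.two_le_pSt Lmax k) _
  exact_mod_cast hnat

/-- Decoding a value within the weight bound from anything congruent to it. [cite: BeigelTarui1994, §2.4] -/
theorem Dk_eq_of_modEq {lam a e₀ Lmax k : ℕ} {z y : ℤ} (hy : |y| ≤ (Wb lam a e₀ k : ℤ))
    (h : z ≡ y [ZMOD (K.Mk lam a e₀ Lmax k : ℤ)]) : K.Dk lam a e₀ Lmax k z = y :=
  AForm.decode_eq (K.two_mul_Wb_lt_Mk lam a e₀ Lmax k) hy h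

/-! ### The invariant of the explicit collapse -/

section invariant

variable {T lam a e₀ Lmax DF WF : ℕ}

/-- **The explicit collapse, stage by stage** (Beigel–Tarui 1994, Lemma 2.5 for the start, Lemma 2.8
/ §2.3 for the stages, made explicit): after `k ≤ Lmax` stages the circuit value is
`[T < 2 · chain k (Rk k (val x))]`, `Rk k` mentions only admissible variables of level `≤ Lmax - k`,
`deg (Rk k) ≤ λ^{E_k}` and `wt (Rk k) ≤ 2^{λ^{E_k}}`. Hypotheses: `λ ≥ 2`; the weight of the top
formula fits (`2T + 1 ≤ 2^{λ^{e₀}}`, `e₀ ≥ 1`); the majority of the `T` randomized copies computes `C`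
on every input (`hmaj`); the output sits at level `≤ Lmax`; the defining polynomials have degree
`≤ DF` and weight `≤ WF` with `m · DF ≤ λ^a`, `5 · WF^m ≤ 2^{λ^a}`. [cite: BeigelTarui1994, Lemma 2.8] -/
theorem inv_explicit (h2 : 2 ≤ lam) (he₀ : 1 ≤ e₀) (hT : 2 * T + 1 ≤ 2 ^ lam ^ e₀)
    (hmaj : ∀ x, K.C.eval x = decide (T < 2 * #(univ.filter fun c : Fin T =>
      (rand K.m K.T₀ (K.βs c) K.C).eval x = true)))
    (hLmax : (K.m + 1) * K.C.acDepth ≤ Lmax)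
    (hD : ∀ v, (K.FF' v).deg ≤ DF) (hW : ∀ v, (K.FF' v).wt ≤ WF) (hW1 : 1 ≤ WF)
    (hDF : K.m * DF ≤ lam ^ a) (hWF : 5 * WF ^ K.m ≤ 2 ^ lam ^ a) :
    ∀ k, k ≤ Lmax →
      (∀ x, K.C.eval x = decide ((T : ℤ) < 2 * K.chain lam a e₀ Lmax k ((K.Rk T lam a e₀ Lmax k).eval (K.val x)))) ∧
      (K.Rk T lam a e₀ Lmax k).VarsIn (fun v => K.Adm v ∧ K.level v ≤ Lmax - k) ∧
      (K.Rk T lam a e₀ Lmax k).deg ≤ lam ^ Eexp a e₀ k ∧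
      (K.Rk T lam a e₀ Lmax k).wt ≤ 2 ^ lam ^ Eexp a e₀ k := by
  have h1 : 1 ≤ lam := le_trans one_le_two h2
  intro k
  induction k with
  | zero =>
    intro _
    refine ⟨fun x => ?_, ?_, ?_, ?_⟩
    · -- the start: sum of the output literals = number of true copies
      rw [hmaj x]
      simp only [Rk, chain, id, AForm.eval_sumL, List.map_map]
      have hsum : ((List.range T).map (AForm.eval (K.val x) ∘ fun c => K.litF c K.C.output)).sum =
          (#(univ.filter fun c : Fin T => (rand K.m K.T₀ (K.βs c) K.C).eval x = true) : ℤ) := by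
        rw [← List.sum_toFinset _ List.nodup_range, List.toFinset_range, Finset.sum_range,
          ← sum_b2i_eq_card]
        refine Finset.sum_congr rfl fun c _ => ?_
        simp only [Function.comp_apply, eval_litF]
        rw [show K.rv c x K.C.output = (rand K.m K.T₀ (K.βs c) K.C).eval x from
          (eval_eq_tval (rand K.m K.T₀ (K.βs c) K.C) x).symm]
        cases (rand K.m K.T₀ (K.βs c) K.C).eval x <;> rfl
      rw [hsum]
      exact decide_eq_decide.2 ⟨fun h => by exact_mod_cast h, fun h => by exact_mod_cast h⟩
    · refine AForm.VarsIn_sumL fun F hF => ?_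
      simp only [List.mem_map] at hF
      obtain ⟨c, -, rfl⟩ := hF
      refine (K.varsIn_litF c K.C.output K.C.wf_output).mono fun w hw => ?_
      rcases hw with ⟨i, rfl⟩ | ⟨j', rfl, hj', hc', hd⟩
      · exact ⟨trivial, Nat.zero_le _⟩
      · refine ⟨⟨hj', hc'⟩, ?_⟩
        show (K.m + 1) * wdepth K.C (.inr j') ≤ Lmax - 0
        rw [hd, ← acDepth_eq_wdepth, Nat.sub_zero]
        exact hLmax
    · refine (AForm.deg_sumL_le (D := 1) fun F hF => ?_).trans (Nat.one_le_pow _ _ (by omega))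
      simp only [List.mem_map] at hF
      obtain ⟨c, -, rfl⟩ := hF
      exact (K.deg_litF c _).le
    · refine (AForm.wt_sumL_le (W := 2) fun F hF => ?_).trans ?_
      · simp only [List.mem_map] at hF
        obtain ⟨c, -, rfl⟩ := hF
        exact K.wt_litF_le c _
      · rw [List.length_map, List.length_range]
        show T * 2 + 1 ≤ 2 ^ lam ^ Eexp a e₀ 0
        simp only [Eexp]; omega
  | succ k ih =>
    intro hk
    obtain ⟨hev, hvars, hdeg, hwt⟩ := ih (Nat.le_of_succ_le hk)
    -- abbreviations
    set R := K.Rk T lam a e₀ Lmax k with hR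
    set E := Eexp a e₀ k with hE_def
    have hE : 1 ≤ E := by
      rw [hE_def]
      cases k with
      | zero => exact he₀
      | succ k => show 1 ≤ 3 * Eexp a e₀ k + a + 5; omega
    have hEsucc : Eexp a e₀ (k + 1) = 3 * E + a + 5 := rfl
    set ℓ := Lmax - k with hℓ
    have hℓ0 : ℓ ≠ 0 := by omega
    have hℓ' : Lmax - (k + 1) = ℓ - 1 := by omega
    set p := K.pSt Lmax k with hp_def
    set κ := kap lam a e₀ k with hκ_def
    set W := Wb lam a e₀ k with hW_def
    have hp2 : 2 ≤ p := K.two_le_pSt Lmax k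
    have hpm : p - 1 ≤ K.m := K.pSt_sub_one_le Lmax k
    have h2E : 2 ≤ lam ^ E := le_trans h2 (by simpa using Nat.pow_le_pow_right h1 hE)
    have hκ2 : 2 ^ κ ≤ 4 * lam ^ E := two_pow_kap_le h2E
    have h3κ : 3 ^ κ ≤ lam ^ (2 * E + 4) := by
      have h16 : 16 ≤ lam ^ 4 := by
        calc 16 = 2 ^ 4 := rfl
          _ ≤ lam ^ 4 := Nat.pow_le_pow_left h2 4
      calc 3 ^ κ ≤ 4 ^ κ := Nat.pow_le_pow_left (by norm_num) _
        _ = (2 ^ κ) ^ 2 := by rw [sq, ← mul_pow]; norm_num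
        _ ≤ (4 * lam ^ E) ^ 2 := Nat.pow_le_pow_left hκ2 2
        _ = 16 * lam ^ (2 * E) := by ring
        _ ≤ lam ^ 4 * lam ^ (2 * E) := Nat.mul_le_mul_right _ h16
        _ = lam ^ (2 * E + 4) := by rw [← pow_add, add_comm]
    have hwtW : R.wt ≤ W := hwt
    refine ⟨fun x => ?_, ?_, ?_, ?_⟩
    · -- value: one more decoder
      show K.C.eval x = decide ((T : ℤ) < 2 * (K.chain lam a e₀ Lmax k
        (K.Dk lam a e₀ Lmax k ((R.subst (K.tau lam a e₀ Lmax k)).eval (K.val x)))))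
      have habs : |R.eval (K.val x)| ≤ (W : ℤ) :=
        (AForm.abs_eval_le_wt (K.abs_val_le x) R).trans (by exact_mod_cast hwtW)
      have hmod : R.eval (K.val x) ≡ (R.subst (K.tau lam a e₀ Lmax k)).eval (K.val x) [ZMOD (K.Mk lam a e₀ Lmax k : ℤ)] := by
        by_cases hex : ∃ v, K.Batch ℓ v
        · obtain ⟨v₀, hv₀⟩ := hex
          have hpv₀ : p = primeOf v₀ := K.pSt_eq_primeOf hv₀ hℓ0
          have hprime : p.Prime := hpv₀ ▸ K.prime_primeOf hv₀.1
          have hB : ∀ v, K.Batch ℓ v → K.val x v = AForm.indNZ p ((K.FF' v).eval (K.val x)) := by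
            intro v hv
            rw [hp_def, K.pSt_eq_primeOf hv hℓ0]
            exact K.val_eq_indNZ' x hv.1 (by rw [hv.2]; exact hℓ0)
          have h := AForm.eval_modEq_eval_collapse (B := K.Batch ℓ) (F := K.FF') hprime κ hB R
          unfold Mk
          push_cast
          exact h
        · have hnone : ∀ v, ¬ K.Batch ℓ v := fun v hv => hex ⟨v, hv⟩
          rw [show (R.subst (K.tau lam a e₀ Lmax k)) = R from
            AForm.subst_collapse_of_empty hnone K.FF' p κ R]
      rw [K.Dk_eq_of_modEq habs hmod.symm]
      exact hev x
    · -- variables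
      show (R.subst (K.tau lam a e₀ Lmax k)).VarsIn fun v => K.Adm v ∧ K.level v ≤ Lmax - (k + 1)
      rw [hℓ']
      refine AForm.VarsIn_subst (fun v hv => AForm.VarsIn_collapseSubst
        (Q := fun w => K.Adm w ∧ K.level w ≤ ℓ - 1) (fun w hw => ?_) (fun w hw hnb => ?_) v hv) hvars
      · exact (K.varsIn_FF' hw.1 (by rw [hw.2]; exact hℓ0)).mono fun u hu =>
          ⟨hu.1, by have := hu.2; have := hw.2; omega⟩
      · refine ⟨hw.1, ?_⟩
        by_contra hc
        exact hnb ⟨hw.1, by have := hw.2; omega⟩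
    · -- degree
      show (R.subst (K.tau lam a e₀ Lmax k)).deg ≤ lam ^ Eexp a e₀ (k + 1)
      rw [hEsucc]
      have hτ : ∀ v, (K.tau lam a e₀ Lmax k v).deg ≤ max 1 (3 ^ κ * ((p - 1) * DF)) := fun v =>
        AForm.deg_collapseSubst_le (fun v _ => hD v) v
      refine (AForm.deg_subst_le hτ R).trans ?_
      have hX : 3 ^ κ * ((p - 1) * DF) ≤ lam ^ (2 * E + 4) * lam ^ a :=
        Nat.mul_le_mul h3κ ((Nat.mul_le_mul_right _ hpm).trans hDF)
      have hmax : max 1 (3 ^ κ * ((p - 1) * DF)) ≤ lam ^ (2 * E + 4) * lam ^ a :=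
        max_le (Nat.succ_le_of_lt (Nat.mul_pos (Nat.pow_pos (by omega)) (Nat.pow_pos (by omega)))) hX
      calc R.deg * max 1 (3 ^ κ * ((p - 1) * DF)) ≤ lam ^ E * (lam ^ (2 * E + 4) * lam ^ a) :=
            Nat.mul_le_mul hdeg hmax
        _ = lam ^ (3 * E + a + 4) := by rw [← pow_add, ← pow_add]; congr 1; ring
        _ ≤ lam ^ (3 * E + a + 5) := Nat.pow_le_pow_right h1 (by omega)
    · -- weight
      show (R.subst (K.tau lam a e₀ Lmax k)).wt ≤ 2 ^ lam ^ Eexp a e₀ (k + 1)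
      rw [hEsucc]
      set Bw := (5 * WF ^ (p - 1)) ^ 3 ^ κ with hBw
      have hτ : ∀ v, (K.tau lam a e₀ Lmax k v).wt ≤ Bw := fun v =>
        AForm.wt_collapseSubst_le hW1 (fun v _ => hW v) v
      have hBw1 : 1 ≤ Bw := Nat.one_le_pow _ _ (Nat.mul_pos (by norm_num) (Nat.pow_pos hW1))
      refine (AForm.wt_subst_le hBw1 hτ R).trans ?_
      have hBw2 : Bw ≤ 2 ^ (lam ^ a * 3 ^ κ) := by
        rw [pow_mul]
        refine Nat.pow_le_pow_left ?_ _
        calc 5 * WF ^ (p - 1) ≤ 5 * WF ^ K.m := Nat.mul_le_mul_left _ (Nat.pow_le_pow_right hW1 hpm)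
          _ ≤ 2 ^ lam ^ a := hWF
      have h3 : lam ^ a * 3 ^ κ * lam ^ E ≤ lam ^ (3 * E + a + 4) :=
        calc lam ^ a * 3 ^ κ * lam ^ E ≤ lam ^ a * lam ^ (2 * E + 4) * lam ^ E :=
              Nat.mul_le_mul_right _ (Nat.mul_le_mul_left _ h3κ)
          _ = lam ^ (3 * E + a + 4) := by rw [← pow_add, ← pow_add]; congr 1; ring
      have h4 : lam ^ E ≤ lam ^ (3 * E + a + 4) := Nat.pow_le_pow_right h1 (by omega)
      have hexp : lam ^ E + lam ^ a * 3 ^ κ * lam ^ E ≤ lam ^ (3 * E + a + 5) :=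
        calc lam ^ E + lam ^ a * 3 ^ κ * lam ^ E ≤ lam ^ (3 * E + a + 4) + lam ^ (3 * E + a + 4) :=
              add_le_add h4 h3
          _ = 2 * lam ^ (3 * E + a + 4) := by ring
          _ ≤ lam * lam ^ (3 * E + a + 4) := Nat.mul_le_mul_right _ h2
          _ = lam ^ (3 * E + a + 4 + 1) := by rw [← pow_succ']
      calc R.wt * Bw ^ R.deg ≤ 2 ^ lam ^ E * (2 ^ (lam ^ a * 3 ^ κ)) ^ lam ^ E :=
            Nat.mul_le_mul hwt ((Nat.pow_le_pow_left hBw2 _).trans (Nat.pow_le_pow_right (by positivity) hdeg))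
        _ = 2 ^ (lam ^ E + lam ^ a * 3 ^ κ * lam ^ E) := by rw [← pow_mul, ← pow_add]
        _ ≤ 2 ^ lam ^ (3 * E + a + 5) := Nat.pow_le_pow_right two_pos hexp

end invariant

/-! ### The explicit `SYM⁺` circuit -/

/-- The input part of a monomial. [folklore] -/
def toIn (A : Finset (V n)) : Finset (Fin n) := univ.filter fun i => Sum.inl i ∈ A

/-- The final modulus `K_f = 2 · Wb + 1` (twice the weight bound plus one). [cite: BeigelTarui1994, Thm. 1.1] -/
def Kf (lam a e₀ L : ℕ) : ℕ := 2 * Wb lam a e₀ L + 1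

/-- The AND-terms read off a formula in the inputs: a monomial with coefficient `a` becomes
`a mod K_f` copies of its set of input variables. [cite: BeigelTarui1994, Thm. 1.1] -/
def termsOf (R : AForm (V n)) (M : ℕ) : List (Finset (Fin n)) :=
  R.expand.flatMap fun q => List.replicate ((q.1 % (M : ℤ)).toNat) (toIn q.2)

/-- The symmetric gate: decode the count modulo `K_f` to the value of the collapsed formula, undo the
stages (`chain`), and compare with `T / 2` (majority of the copies). [cite: BeigelTarui1994, Thm. 1.1] -/
def symOf (T lam a e₀ Lmax : ℕ) (N : ℕ) : Bool :=
  decide ((T : ℤ) < 2 * K.chain lam a e₀ Lmax Lmax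
    ((((N : ℕ) : ℤ) + Wb lam a e₀ Lmax) % (Kf lam a e₀ Lmax : ℤ) - Wb lam a e₀ Lmax))

/-- **The explicit `SYM⁺` circuit** of the setup after `Lmax` stages. [cite: BeigelTarui1994, Thm. 1.1] -/
noncomputable def explicitSymPlus (T lam a e₀ Lmax : ℕ) : SymPlus n :=
  ⟨termsOf (K.Rk T lam a e₀ Lmax Lmax) (Kf lam a e₀ Lmax), K.symOf T lam a e₀ Lmax⟩

section symplus

variable {T lam a e₀ Lmax : ℕ}

/-- **Size of the explicit circuit**: `≤ 2^{λ^{E+2}}` if `wt ≤ 2^{λ^E}`. [cite: BeigelTarui1994, Thm. 1.1] -/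
theorem size_explicitSymPlus_le (h2 : 2 ≤ lam)
    (hwt : (K.Rk T lam a e₀ Lmax Lmax).wt ≤ 2 ^ lam ^ Eexp a e₀ Lmax) :
    (K.explicitSymPlus T lam a e₀ Lmax).size ≤ 2 ^ lam ^ (Eexp a e₀ Lmax + 2) := by
  set R := K.Rk T lam a e₀ Lmax Lmax
  set E := Eexp a e₀ Lmax
  set M := Kf lam a e₀ Lmax with hM
  have hM0 : (0 : ℤ) < M := by
    have : 0 < M := by rw [hM]; unfold Kf; omega
    exact_mod_cast this
  show (termsOf R M).length ≤ _
  unfold termsOf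
  rw [length_flatMap_replicate]
  have hsum : (R.expand.map fun q => (q.1 % (M : ℤ)).toNat).sum ≤ R.expand.length * M := by
    have := List.sum_le_card_nsmul (R.expand.map fun q => (q.1 % (M : ℤ)).toNat) M (by
      intro y hy
      simp only [List.mem_map] at hy
      obtain ⟨q, -, rfl⟩ := hy
      exact Int.toNat_le.2 (Int.emod_lt_of_pos _ hM0).le)
    simpa [List.length_map, smul_eq_mul] using this
  refine hsum.trans ?_
  have hlen := AForm.length_expand_le_wt R
  have h22 : 2 * lam ^ E + 2 ≤ lam ^ (E + 2) := by
    have : 4 * lam ^ E ≤ lam ^ (E + 2) := by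
      rw [pow_add]
      calc 4 * lam ^ E = lam ^ E * 2 ^ 2 := by ring
        _ ≤ lam ^ E * lam ^ 2 := Nat.mul_le_mul_left _ (Nat.pow_le_pow_left h2 2)
    have h1E : 1 ≤ lam ^ E := Nat.one_le_pow _ _ (by omega)
    omega
  calc R.expand.length * M ≤ 2 ^ lam ^ E * 2 ^ (lam ^ E + 2) := by
        refine Nat.mul_le_mul (hlen.trans hwt) ?_
        show 2 * 2 ^ lam ^ E + 1 ≤ 2 ^ (lam ^ E + 2)
        rw [pow_add]
        have := Nat.one_le_two_pow (n := lam ^ E)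
        omega
    _ = 2 ^ (2 * lam ^ E + 2) := by rw [← pow_add]; congr 1; ring
    _ ≤ 2 ^ lam ^ (E + 2) := Nat.pow_le_pow_right two_pos h22

/-- **Fan-in of the explicit circuit**: `≤ λ^{E+2}` if `deg ≤ λ^E`. [cite: BeigelTarui1994, Thm. 1.1] -/
theorem maxFanIn_explicitSymPlus_le (h2 : 2 ≤ lam)
    (hdeg : (K.Rk T lam a e₀ Lmax Lmax).deg ≤ lam ^ Eexp a e₀ Lmax) :
    (K.explicitSymPlus T lam a e₀ Lmax).maxFanIn ≤ lam ^ (Eexp a e₀ Lmax + 2) := by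
  refine SymPlus.maxFanIn_le fun t ht => ?_
  simp only [explicitSymPlus, termsOf, List.mem_flatMap, List.mem_replicate] at ht
  obtain ⟨q, hq, -, rfl⟩ := ht
  calc (toIn q.2).card ≤ q.2.card := Finset.card_le_card_of_injOn Sum.inl
        (fun i hi => (mem_filter.1 hi).2) (fun a _ b _ hab => Sum.inl_injective hab)
    _ ≤ (K.Rk T lam a e₀ Lmax Lmax).deg := AForm.card_le_deg_of_mem_expand _ hq
    _ ≤ lam ^ Eexp a e₀ Lmax := hdeg
    _ ≤ lam ^ (Eexp a e₀ Lmax + 2) := Nat.pow_le_pow_right (by omega) (by omega)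

/-- **Value of the explicit circuit**: if the collapsed formula mentions inputs only, has weight
within the bound, and its value decodes to the circuit value through `chain`, then the explicit
`SYM⁺` circuit computes `C` (Beigel–Tarui 1994, end of §2.3 and proof of Thm. 1.1; Williams 2014,
App. A, Transformation 4). [cite: BeigelTarui1994, Thm. 1.1] -/
theorem eval_explicitSymPlus
    (hev : ∀ x, K.C.eval x = decide ((T : ℤ) < 2 * K.chain lam a e₀ Lmax Lmax
      ((K.Rk T lam a e₀ Lmax Lmax).eval (K.val x))))
    (hvars : (K.Rk T lam a e₀ Lmax Lmax).VarsIn (fun v => K.Adm v ∧ K.level v ≤ 0))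
    (hwt : (K.Rk T lam a e₀ Lmax Lmax).wt ≤ 2 ^ lam ^ Eexp a e₀ Lmax) (x : Fin n → Bool) :
    (K.explicitSymPlus T lam a e₀ Lmax).eval x = K.C.eval x := by
  classical
  set R := K.Rk T lam a e₀ Lmax Lmax with hR
  set W := Wb lam a e₀ Lmax with hW
  set M := Kf lam a e₀ Lmax with hM
  have hinp : R.VarsIn fun v => ∃ i, v = Sum.inl i :=
    hvars.mono fun v hv => K.exists_inl_of_level hv.1 (Nat.le_zero.1 hv.2)
  -- the `{0,1}`-point of the input (auxiliary coordinates set to `0`)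
  let ν : (Fin n → Bool) → V n → ℤ := fun x v => Sum.elim (fun i => b2i (x i)) (fun _ => 0) v
  have hν01 : ∀ x v, ν x v = 0 ∨ ν x v = 1 := fun x v => by
    rcases v with i | t
    · exact b2i_zero_or_one (x i)
    · exact Or.inl rfl
  have hνabs : ∀ x v, |ν x v| ≤ 1 := fun x v => by rcases hν01 x v with h | h <;> simp [h]
  have hevν : R.eval (K.val x) = R.eval (ν x) :=
    AForm.eval_congr_of_varsIn (fun v ⟨i, hi⟩ => by subst hi; rfl) hinp
  have hM0 : (0 : ℤ) < M := by
    have : 0 < M := by rw [hM]; unfold Kf; omega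
    exact_mod_cast this
  have hMW : 2 * (W : ℤ) < M := by rw [hM, Kf, ← hW]; push_cast; linarith
  have hmono : ∀ q ∈ R.expand, AForm.mono (ν x) q.2 = b2i (decide (∀ i ∈ toIn q.2, x i = true)) := by
    intro q hq
    have hq' := AForm.forall_mem_expand_of_varsIn hinp q hq
    have key : (∀ v ∈ q.2, ν x v = 1) ↔ ∀ i ∈ toIn q.2, x i = true := by
      constructor
      · intro hall i hi
        have hi' : Sum.inl i ∈ q.2 := (mem_filter.1 hi).2
        have h1' := hall _ hi'
        cases hx : x i
        · simp [ν, hx] at h1'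
        · rfl
      · intro hall v hv
        obtain ⟨i, rfl⟩ := hq' v hv
        have := hall i (mem_filter.2 ⟨mem_univ _, hv⟩)
        simp [ν, this]
    unfold AForm.mono
    by_cases hc : ∀ v ∈ q.2, ν x v = 1
    · rw [if_pos hc, decide_eq_true (key.1 hc)]; rfl
    · rw [if_neg hc, decide_eq_false (fun h' => hc (key.2 h'))]; rfl
  have hcount : (((K.explicitSymPlus T lam a e₀ Lmax).count x : ℕ) : ℤ) ≡ R.eval (ν x) [ZMOD M] := by
    rw [show (K.explicitSymPlus T lam a e₀ Lmax).count x = _ from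
      countP_flatMap_replicate R.expand (fun q => (q.1 % (M : ℤ)).toNat) (fun q => toIn q.2)
        (fun t => decide (∀ i ∈ t, x i = true)), Nat.cast_list_sum, List.map_map,
      AForm.eval_eq_expand (hν01 x) R]
    refine list_sum_modEq _ fun q hq => ?_
    simp only [Function.comp_apply]
    rw [hmono q hq]
    split_ifs with hs
    · have hs' : ∀ i ∈ toIn q.2, x i = true := of_decide_eq_true hs
      rw [decide_eq_true hs', b2i_true, mul_one, Int.toNat_of_nonneg (Int.emod_nonneg _ hM0.ne')]
      exact Int.mod_modEq _ _
    · have hs' : ¬ ∀ i ∈ toIn q.2, x i = true := fun h' => hs (decide_eq_true h')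
      rw [decide_eq_false hs', b2i_false, mul_zero, Nat.cast_zero]
  have habs : |R.eval (ν x)| ≤ (W : ℤ) :=
    (AForm.abs_eval_le_wt (hνabs x) R).trans (by rw [hW]; exact_mod_cast hwt)
  show K.symOf T lam a e₀ Lmax ((K.explicitSymPlus T lam a e₀ Lmax).count x) = K.C.eval x
  unfold symOf
  rw [← hW, ← hM, AForm.decode_eq hMW habs hcount, ← hevν, ← hev x]

end symplus

/-! ### The explicit circuit of an `ACC` circuit, with the Valiant–Vazirani seeds -/

end Setup

/-- The size parameter of a circuit: the larger of its number of gates and its fan-in. [folklore] -/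
def sC {n : ℕ} (C : Circuit (Fin n)) : ℕ := max C.gates.length C.maxFanIn

/-- `λ_C = log₂ s_C + 2`. [folklore] -/
def lamC {n : ℕ} (C : Circuit (Fin n)) : ℕ := Nat.log 2 (sC C) + 2

/-- The exponent of the conversion for depth `d` and modulus `m`. [folklore] -/
def eConv (d m : ℕ) : ℕ := Setup.Eexp (4 * m + 10) 7 ((m + 1) * d) + 2

/-- The setup of a circuit over `accBasis m`: modulus `m`, `vvT₀ s_C` trials, the circuit, and the
Valiant–Vazirani seeds `vvSeed s_C`. [cite: Williams2014, Appendix A] -/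
def setupOf (m : ℕ) (hm : 2 ≤ m) {n : ℕ} (C : Circuit (Fin n)) (hC : C.IsOver (accBasis m)) :
    Setup n := ⟨m, vvT₀ (sC C), C, vvSeed (sC C), hm, hC⟩

/-- **The explicit `SYM⁺` circuit of an `ACC` circuit** (Williams 2014, Lemma 4.1 / App. A;
Beigel–Tarui 1994, Thm. 1.1): for a circuit over `accBasis m`, the explicit collapse of its setup
with `T = vvT s_C` copies, `λ = log₂ s_C + 2`, `a = 4m + 10`, `e₀ = 7`, `Lmax = (m+1)·d`; for other
circuits (never used) the empty circuit. [cite: Williams2014, Lemma 4.1 and Appendix A] -/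
noncomputable def accSymPlus (d m : ℕ) (hm : 2 ≤ m) {n : ℕ} (C : Circuit (Fin n)) : SymPlus n := by
  classical
  exact if hC : C.IsOver (accBasis m) then
    (setupOf m hm C hC).explicitSymPlus (vvT (sC C)) (lamC C) (4 * m + 10) 7 ((m + 1) * d)
  else ⟨[], fun _ => false⟩

/-- Unfolding `accSymPlus` on a circuit over `accBasis m`. [folklore] -/
theorem accSymPlus_eq (d m : ℕ) (hm : 2 ≤ m) {n : ℕ} (C : Circuit (Fin n)) (hC : C.IsOver (accBasis m)) :
    accSymPlus d m hm C =
      (setupOf m hm C hC).explicitSymPlus (vvT (sC C)) (lamC C) (4 * m + 10) 7 ((m + 1) * d) := by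
  unfold accSymPlus
  exact dif_pos hC

/-- **The invariant for the setup of a circuit**, all hypotheses discharged: after all
`(m+1)·d` stages (for `acDepth C ≤ d`). [cite: BeigelTarui1994, Lemma 2.8] -/
theorem inv_setupOf (d m : ℕ) (hm : 2 ≤ m) {n : ℕ} (C : Circuit (Fin n)) (hC : C.IsOver (accBasis m))
    (hd : C.acDepth ≤ d) :
    (∀ x, C.eval x = decide ((vvT (sC C) : ℤ) < 2 *
        (setupOf m hm C hC).chain (lamC C) (4 * m + 10) 7 ((m + 1) * d) ((m + 1) * d)
        (((setupOf m hm C hC).Rk (vvT (sC C)) (lamC C) (4 * m + 10) 7 ((m + 1) * d) ((m + 1) * d)).eval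
          ((setupOf m hm C hC).val x)))) ∧
      ((setupOf m hm C hC).Rk (vvT (sC C)) (lamC C) (4 * m + 10) 7 ((m + 1) * d) ((m + 1) * d)).VarsIn
        (fun v => (setupOf m hm C hC).Adm v ∧ (setupOf m hm C hC).level v ≤ 0) ∧
      ((setupOf m hm C hC).Rk (vvT (sC C)) (lamC C) (4 * m + 10) 7 ((m + 1) * d) ((m + 1) * d)).deg ≤
        lamC C ^ Setup.Eexp (4 * m + 10) 7 ((m + 1) * d) ∧
      ((setupOf m hm C hC).Rk (vvT (sC C)) (lamC C) (4 * m + 10) 7 ((m + 1) * d) ((m + 1) * d)).wt ≤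
        2 ^ lamC C ^ Setup.Eexp (4 * m + 10) 7 ((m + 1) * d) := by
  set K := setupOf m hm C hC with hK
  have hsize : C.gates.length ≤ sC C := le_max_left _ _
  have hfan : C.maxFanIn ≤ sC C := le_max_right _ _
  have h2 : 2 ≤ lamC C := by unfold lamC; omega
  obtain ⟨hDF, hWF⟩ := numeric_bounds_vv (sC C) hm
  obtain ⟨h1, h2', h3, h4⟩ := K.inv_explicit (T := vvT (sC C)) (lam := lamC C) (a := 4 * m + 10) (e₀ := 7)
    (Lmax := (m + 1) * d) (DF := vvT₀ (sC C) + m ^ 3) (WF := (3 * sC C + 3) ^ (vvT₀ (sC C) + m ^ 3))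
    h2 (by norm_num) (two_mul_vvT_succ_le (sC C)) (fun x => vv_majority m C hsize hfan x)
    (Nat.mul_le_mul_left _ hd) (fun v => K.deg_FF'_le v)
    (fun v => K.wt_FF'_le hfan (one_le_vvT₀ _) v) (Nat.one_le_pow _ _ (by omega)) hDF hWF
    ((m + 1) * d) le_rfl
  refine ⟨h1, h2'.mono fun v hv => ⟨hv.1, ?_⟩, h3, h4⟩
  have := hv.2
  rwa [Nat.sub_self] at this

/-- **The explicit `SYM⁺` circuit is small, of polylogarithmic fan-in, and computes the circuit**:
for `C` over `accBasis m` of `acDepth ≤ d` with at most `s` gates of fan-in `≤ s`,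
`size ≤ 2^{(log₂ s + 2)^e}`, `maxFanIn ≤ (log₂ s + 2)^e` and `accSymPlus d m hm C ≡ C`, with
`e = eConv d m` (Williams 2014, Lemma 4.1: "an equivalent `SYM⁺` circuit of `s^{O(log^{f(d)} s)}`
size" with ANDs of `poly(log s)` fan-in; Beigel–Tarui 1994, Thm. 1.1).
[cite: Williams2014, Lemma 4.1 and Appendix A] -/
theorem accSymPlus_spec (d m : ℕ) (hm : 2 ≤ m) {n s : ℕ} (C : Circuit (Fin n))
    (hC : C.IsOver (accBasis m)) (hd : C.acDepth ≤ d) (hsize : C.size ≤ s) (hfan : C.maxFanIn ≤ s) :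
    (accSymPlus d m hm C).size ≤ 2 ^ (Nat.log 2 s + 2) ^ eConv d m ∧
      (accSymPlus d m hm C).maxFanIn ≤ (Nat.log 2 s + 2) ^ eConv d m ∧
      ∀ x, (accSymPlus d m hm C).eval x = C.eval x := by
  obtain ⟨hev, hvars, hdeg, hwt⟩ := inv_setupOf d m hm C hC hd
  rw [accSymPlus_eq d m hm C hC]
  have h2 : 2 ≤ lamC C := by unfold lamC; omega
  have hsC : sC C ≤ s := max_le hsize hfan
  have hlam : lamC C ≤ Nat.log 2 s + 2 := Nat.add_le_add_right (Nat.log_mono_right hsC) 2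
  have h1 : 1 ≤ lamC C := by omega
  refine ⟨?_, ?_, fun x => ?_⟩
  · refine ((setupOf m hm C hC).size_explicitSymPlus_le h2 hwt).trans ?_
    exact Nat.pow_le_pow_right two_pos (Nat.pow_le_pow_left hlam _)
  · exact ((setupOf m hm C hC).maxFanIn_explicitSymPlus_le h2 hdeg).trans (Nat.pow_le_pow_left hlam _)
  · exact (setupOf m hm C hC).eval_explicitSymPlus hev hvars hwt x

end BT

end Literature.Computability.Complexity
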